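import Summits.QuantumFields.YangMills.Theorems.WeakCouplingRatesDirichletHodge

/-!
# Route `WeakCouplingRates`, crux `ColdBoxTwoPointFloorW` (stmt-QuantumFields-19608): the cut-off potential and the remainder of
# the Dirichlet Hodge split — plateau identities and `O(H⁻⁴)` sizes (S3c-iii content)

Helper file (fleet seat `ym-wcr-19608-p2`; line `birth`).  Companion of `Theorems/WeakCouplingRatesDirichletHodge.lean` and
`Theorems/WeakCouplingRatesBoxCutoff.lean`:

* `exists_div₂_greenTensor_bound` — decay of the potential `|(div₂ g_q)(y)| ≤ K_φ/‖y − x_q‖³` (Lawler (1.36), tree);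
* `d₁_cutoff_eq_of_plateau`, `dirRemainder_eq_zero_of_plateau` — on the plateau `‖y − c‖ ≤ H/2 − 2` of the ramp `boxCutoff H` the
  cut-off potential has the full curl and the remainder `V_q = d₁((1−χ)φ_q) + div₃((1−χ)W_q)` vanishes;
* `abs_dirRemainder_le` — off the plateau `|V_q| ≤ (256K_φ + 512K_W)/H⁴`: the `(1−χ)`-terms cancel by the Hodge split off the source,
  only gradient-of-`χ` terms (slope `2/H`) against `O(H⁻³)` potentials survive; `abs_d₁_cutoff_le` — `|d₁(χφ_q)| ≤ (256K_Z + 256K_φ)/H⁴`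
  off the plateau.

No sorry, standard axioms; no new definition.  NOT a claim about the mass gap.
-/

set_option autoImplicit false

noncomputable section

open Finset Matrix Real
open Literature.Probability.LatticeModels
open Literature.MathematicalPhysics.QuantumLattice
open Literature.MathematicalPhysics.QuantumFieldTheory
open Literature.MathematicalPhysics.QuantumFieldTheory.LatticeMaxwell
open Literature.MathematicalPhysics.QuantumFieldTheory.AxialGauge
open Literature.MathematicalPhysics.QuantumFieldTheory.LatticeChain
open Literature.MathematicalPhysics.QuantumFieldTheory.LatticeForm (e d₀ d₁ d₂)

namespace Summit.QuantumFields.YangMills.Theorems.WeakCouplingRates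

/-! ## Decay of the potential `φ_q = div₂ g_q` -/

/-- **Decay of the potential**: `|(div₂ g_q)(y; k)| ≤ K_φ/‖y − x_q‖³` for `y ≠ x_q`. -/
theorem exists_div₂_greenTensor_bound : ∃ K : ℝ, 0 ≤ K ∧ ∀ (q : Plaq 4) (y : Site 4) (k : Fin 4),
    y ≠ q.1 → |div₂ (greenTensor q) y k| ≤ K / ‖y - q.1‖ ^ 3 := by
  obtain ⟨K, hK0, hK⟩ := exists_latticeGreen_grad_bound
  refine ⟨4 * (K / 2), by positivity, fun q y k hy => ?_⟩
  have hz : y - q.1 ≠ 0 := sub_ne_zero.2 hy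
  set z := y - q.1 with hz'
  have hterm : ∀ m : Fin 4, |greenTensor q (y - e m) m k - greenTensor q y m k| ≤ K / 2 / ‖z‖ ^ 3 := by
    intro m
    have e1 : y - e m - q.1 = z - e m := by rw [hz']; abel
    simp only [greenTensor, e1]
    rw [← hz']
    set ω : ℝ := (if m = q.2.1 ∧ k = q.2.2 then 1 else 0) - (if m = q.2.2 ∧ k = q.2.1 then 1 else 0) with hω
    have halg : latticeGreen (z - e m) / 2 * ω - latticeGreen z / 2 * ω = (latticeGreen (z - e m) - latticeGreen z) / 2 * ω := by
      ring
    rw [halg, abs_mul, abs_div, abs_two]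
    have h1 := (hK z hz m).2
    have h2 : |ω| ≤ 1 := abs_orient_le_one q.2.1 q.2.2 m k
    have h3 : 0 ≤ |latticeGreen (z - e m) - latticeGreen z| / 2 := by positivity
    calc |latticeGreen (z - e m) - latticeGreen z| / 2 * |ω| ≤ |latticeGreen (z - e m) - latticeGreen z| / 2 * 1 :=
          mul_le_mul_of_nonneg_left h2 h3
      _ ≤ K / ‖z‖ ^ 3 / 2 := by linarith
      _ = K / 2 / ‖z‖ ^ 3 := by ring
  simp only [div₂]
  refine (Finset.abs_sum_le_sum_abs _ _).trans ?_
  calc ∑ m : Fin 4, |greenTensor q (y - e m) m k - greenTensor q y m k| ≤ ∑ _m : Fin 4, K / 2 / ‖z‖ ^ 3 :=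
        Finset.sum_le_sum fun m _ => hterm m
    _ = 4 * (K / 2) / ‖z‖ ^ 3 := by
        rw [Finset.sum_const, Finset.card_univ, Fintype.card_fin, nsmul_eq_mul]; push_cast; ring

/-! ## The cut-off potential `A_x = d₁(χ φ_x)` and the remainder `V_x = d₁((1−χ)φ_x) + div₃((1−χ)W_x)` -/

/-- On the plateau the cut-off potential has the full curl: `d₁(χφ_x)(y;k,l) = (d₁ φ_x)(y;k,l)` if `‖y − c‖ ≤ H/2 − 2`. -/
theorem d₁_cutoff_eq_of_plateau {H : ℕ} (hH : 0 < H) (φ : Site 4 → Fin 4 → ℝ) {y : Site 4}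
    (hy : ‖y - boxCentre H‖ ≤ (H : ℝ) / 2 - 2) (k l : Fin 4) :
    d₁ (fun x i => boxCutoff H x * φ x i) y k l = d₁ φ y k l := by
  have hplus : ∀ m : Fin 4, boxCutoff H (y + e m) = 1 := by
    intro m
    refine boxCutoff_eq_one hH ?_
    have : ‖y + e m - boxCentre H‖ ≤ ‖y - boxCentre H‖ + 1 := by
      have h := norm_add_le (y - boxCentre H) (e m)
      rw [norm_e, show y - boxCentre H + e m = y + e m - boxCentre H by abel] at h
      exact h
    linarith
  have h0 : boxCutoff H y = 1 := boxCutoff_eq_one hH (by linarith)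
  rw [d₁_smul_site, h0, hplus, hplus]
  ring

/-- The remainder vanishes on the plateau `‖y − c‖ ≤ H/2 − 2`. -/
theorem dirRemainder_eq_zero_of_plateau {H : ℕ} (hH : 0 < H) (q : Plaq 4) {y : Site 4}
    (hy : ‖y - boxCentre H‖ ≤ (H : ℝ) / 2 - 2) (k l : Fin 4) :
    d₁ (fun x i => (1 - boxCutoff H x) * div₂ (greenTensor q) x i) y k l +
      div₃ (fun y a b c => (1 - boxCutoff H y) * d₂ (greenTensor q) y a b c) y k l = 0 := by
  rw [div₃_cutoff_eq_zero hH _ hy, add_zero]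
  have hplus : ∀ m : Fin 4, boxCutoff H (y + e m) = 1 := by
    intro m
    refine boxCutoff_eq_one hH ?_
    have : ‖y + e m - boxCentre H‖ ≤ ‖y - boxCentre H‖ + 1 := by
      have h := norm_add_le (y - boxCentre H) (e m)
      rw [norm_e, show y - boxCentre H + e m = y + e m - boxCentre H by abel] at h
      exact h
    linarith
  have h0 : boxCutoff H y = 1 := boxCutoff_eq_one hH (by linarith)
  rw [d₁_smul_site, h0, hplus, hplus]
  ring

/-- **The remainder off the plateau is `O(H⁻⁴)`**: with the decay constants of the potential and the co-potential, for `H ≥ 32`,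
`‖x_q − c‖ ≤ H/8` and `‖y − c‖ > H/2 − 2`: `|V_q(y;k,l)| ≤ (256 K_φ + 512 K_W)/H⁴` — the `(1−χ)`-terms cancel by the Hodge
split (`d₁φ_q + div₃ W_q = δ_q = 0` off the source), only the gradient-of-`χ` terms remain. -/
theorem abs_dirRemainder_le {K_φ K_W : ℝ} (hKφ0 : 0 ≤ K_φ) (hKW0 : 0 ≤ K_W)
    (hKφ : ∀ (q : Plaq 4) (y : Site 4) (k : Fin 4), y ≠ q.1 → |div₂ (greenTensor q) y k| ≤ K_φ / ‖y - q.1‖ ^ 3)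
    (hKW : ∀ (q : Plaq 4) (y : Site 4) (a b c : Fin 4), y ≠ q.1 → |d₂ (greenTensor q) y a b c| ≤ K_W / ‖y - q.1‖ ^ 3)
    {H : ℕ} (hH : (32 : ℝ) ≤ H) {q : Plaq 4} (hq : ‖q.1 - boxCentre H‖ ≤ (H : ℝ) / 8) {y : Site 4}
    (hy : (H : ℝ) / 2 - 2 < ‖y - boxCentre H‖) (k l : Fin 4) :
    |d₁ (fun x i => (1 - boxCutoff H x) * div₂ (greenTensor q) x i) y k l +
        div₃ (fun y a b c => (1 - boxCutoff H y) * d₂ (greenTensor q) y a b c) y k l| ≤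
      (256 * K_φ + 512 * K_W) / (H : ℝ) ^ 4 := by
  have hH0 : (0 : ℝ) < H := by linarith
  have hHn : 0 < H := by exact_mod_cast hH0
  have hr := dist_off_plateau hH hy hq
  have hyq : y ≠ q.1 := by
    intro h; rw [h, sub_self, norm_zero] at hr; linarith
  -- the Hodge split off the source: `(1−χ)(Z + U) = 0`
  have hZU : d₁ (div₂ (greenTensor q)) y k l + div₃ (d₂ (greenTensor q)) y k l = 0 := by
    have h := congrFun (congrFun (congrFun (d₁_div₂_add_div₃_d₂_greenTensor (by norm_num : 3 ≤ 4) q) y) k) l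
    simp only [Pi.add_apply] at h
    rw [h, plaqChain_eq_zero_of_ne hyq]
  rw [d₁_smul_site, div₃_one_sub_smul]
  -- bounds on the gradient-of-χ terms
  have hχdiff : ∀ v : Site 4, ‖v‖ = 1 → ∀ w : Site 4, |boxCutoff H (w + v) - boxCutoff H w| ≤ 2 / H := by
    intro v hv w
    have := abs_boxCutoff_sub_le hHn (w + v) w
    rwa [show w + v - w = v by abel, hv, mul_one] at this
  have hφb : ∀ m : Fin 4, ∀ i : Fin 4, |div₂ (greenTensor q) (y + e m) i| ≤ K_φ / ((H : ℝ) / 4) ^ 3 := by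
    intro m i
    have hd : (H : ℝ) / 4 ≤ ‖y + e m - q.1‖ := by
      have := norm_sub_norm_le (y - q.1) (-(e m))
      rw [norm_neg, norm_e, show y - q.1 - -e m = y + e m - q.1 by abel] at this
      linarith
    have hne : y + e m ≠ q.1 := by
      intro h; rw [h, sub_self, norm_zero] at hd; linarith
    exact (hKφ q (y + e m) i hne).trans (div_pow_le_div_pow hKφ0 (by positivity) hd 3)
  have hWb : ∀ m : Fin 4, |d₂ (greenTensor q) (y - e m) m k l| ≤ K_W / ((H : ℝ) / 4) ^ 3 := by
    intro m
    have hd : (H : ℝ) / 4 ≤ ‖y - e m - q.1‖ := by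
      have := norm_sub_norm_le (y - q.1) (e m)
      rw [norm_e, show y - q.1 - e m = y - e m - q.1 by abel] at this
      linarith
    have hne : y - e m ≠ q.1 := by
      intro h; rw [h, sub_self, norm_zero] at hd; linarith
    exact (hKW q (y - e m) m k l hne).trans (div_pow_le_div_pow hKW0 (by positivity) hd 3)
  have hk := hχdiff (e k) (norm_e k) y
  have hl := hχdiff (e l) (norm_e l) y
  have hm : ∀ m : Fin 4, |boxCutoff H y - boxCutoff H (y - e m)| ≤ 2 / H := by
    intro m
    have := hχdiff (e m) (norm_e m) (y - e m)
    rwa [show y - e m + e m = y by abel] at this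
  -- assemble
  have e4 : (2 / (H : ℝ)) * (K_φ / ((H : ℝ) / 4) ^ 3) = 128 * K_φ / (H : ℝ) ^ 4 := by field_simp; ring
  have e5 : (2 / (H : ℝ)) * (K_W / ((H : ℝ) / 4) ^ 3) = 128 * K_W / (H : ℝ) ^ 4 := by field_simp; ring
  have t1 : |(1 - boxCutoff H (y + e k) - (1 - boxCutoff H y)) * div₂ (greenTensor q) (y + e k) l| ≤ 128 * K_φ / (H : ℝ) ^ 4 := by
    rw [abs_mul, show (1 - boxCutoff H (y + e k) - (1 - boxCutoff H y)) = -(boxCutoff H (y + e k) - boxCutoff H y) by ring,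
      abs_neg, ← e4]
    exact mul_le_mul hk (hφb k l) (abs_nonneg _) (by positivity)
  have t2 : |(1 - boxCutoff H (y + e l) - (1 - boxCutoff H y)) * div₂ (greenTensor q) (y + e l) k| ≤ 128 * K_φ / (H : ℝ) ^ 4 := by
    rw [abs_mul, show (1 - boxCutoff H (y + e l) - (1 - boxCutoff H y)) = -(boxCutoff H (y + e l) - boxCutoff H y) by ring,
      abs_neg, ← e4]
    exact mul_le_mul hl (hφb l k) (abs_nonneg _) (by positivity)
  have t3 : |∑ m : Fin 4, (boxCutoff H y - boxCutoff H (y - e m)) * d₂ (greenTensor q) (y - e m) m k l| ≤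
      512 * K_W / (H : ℝ) ^ 4 := by
    refine (Finset.abs_sum_le_sum_abs _ _).trans ?_
    have hterm : ∀ m : Fin 4, |(boxCutoff H y - boxCutoff H (y - e m)) * d₂ (greenTensor q) (y - e m) m k l| ≤
        128 * K_W / (H : ℝ) ^ 4 := by
      intro m
      rw [abs_mul, ← e5]
      exact mul_le_mul (hm m) (hWb m) (abs_nonneg _) (by positivity)
    calc ∑ m : Fin 4, |(boxCutoff H y - boxCutoff H (y - e m)) * d₂ (greenTensor q) (y - e m) m k l|
        ≤ ∑ _m : Fin 4, 128 * K_W / (H : ℝ) ^ 4 := Finset.sum_le_sum fun m _ => hterm m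
      _ = 512 * K_W / (H : ℝ) ^ 4 := by
          rw [Finset.sum_const, Finset.card_univ, Fintype.card_fin, nsmul_eq_mul]; push_cast; ring
  have hmain : (1 - boxCutoff H y) * d₁ (div₂ (greenTensor q)) y k l +
      (1 - boxCutoff H (y + e k) - (1 - boxCutoff H y)) * div₂ (greenTensor q) (y + e k) l -
      (1 - boxCutoff H (y + e l) - (1 - boxCutoff H y)) * div₂ (greenTensor q) (y + e l) k +
      ((1 - boxCutoff H y) * div₃ (d₂ (greenTensor q)) y k l +
        ∑ m : Fin 4, (boxCutoff H y - boxCutoff H (y - e m)) * d₂ (greenTensor q) (y - e m) m k l) =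
      (1 - boxCutoff H y) * (d₁ (div₂ (greenTensor q)) y k l + div₃ (d₂ (greenTensor q)) y k l) +
      ((1 - boxCutoff H (y + e k) - (1 - boxCutoff H y)) * div₂ (greenTensor q) (y + e k) l -
      (1 - boxCutoff H (y + e l) - (1 - boxCutoff H y)) * div₂ (greenTensor q) (y + e l) k +
        ∑ m : Fin 4, (boxCutoff H y - boxCutoff H (y - e m)) * d₂ (greenTensor q) (y - e m) m k l) := by ring
  rw [hmain, hZU, mul_zero, zero_add]
  have e6 : (256 * K_φ + 512 * K_W) / (H : ℝ) ^ 4 = 128 * K_φ / (H : ℝ) ^ 4 + 128 * K_φ / (H : ℝ) ^ 4 + 512 * K_W / (H : ℝ) ^ 4 := by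
    ring
  rw [e6]
  refine (abs_add_le _ _).trans (add_le_add ((abs_sub _ _).trans (add_le_add t1 t2)) t3)

/-- **Size of the cut-off potential off the plateau**: `|d₁(χφ_x)(y;k,l)| ≤ (256 K_Z + 256 K_φ)/H⁴` for `H ≥ 32`,
`‖x_x − c‖ ≤ H/8`, `‖y − c‖ > H/2 − 2`. -/
theorem abs_d₁_cutoff_le {K_Z K_φ : ℝ} (hKZ0 : 0 ≤ K_Z) (hKφ0 : 0 ≤ K_φ)
    (hKZ : ∀ (q : Plaq 4) (y : Site 4) (k l : Fin 4), 3 ≤ ‖y - q.1‖ →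
      |d₁ (div₂ (greenTensor q)) y k l| ≤ K_Z / ‖y - q.1‖ ^ 4)
    (hKφ : ∀ (q : Plaq 4) (y : Site 4) (k : Fin 4), y ≠ q.1 → |div₂ (greenTensor q) y k| ≤ K_φ / ‖y - q.1‖ ^ 3)
    {H : ℕ} (hH : (32 : ℝ) ≤ H) {q : Plaq 4} (hq : ‖q.1 - boxCentre H‖ ≤ (H : ℝ) / 8) {y : Site 4}
    (hy : (H : ℝ) / 2 - 2 < ‖y - boxCentre H‖) (k l : Fin 4) :
    |d₁ (fun x i => boxCutoff H x * div₂ (greenTensor q) x i) y k l| ≤ (256 * K_Z + 256 * K_φ) / (H : ℝ) ^ 4 := by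
  have hH0 : (0 : ℝ) < H := by linarith
  have hHn : 0 < H := by exact_mod_cast hH0
  have hr := dist_off_plateau hH hy hq
  rw [d₁_smul_site]
  have hχdiff : ∀ v : Site 4, ‖v‖ = 1 → ∀ w : Site 4, |boxCutoff H (w + v) - boxCutoff H w| ≤ 2 / H := by
    intro v hv w
    have := abs_boxCutoff_sub_le hHn (w + v) w
    rwa [show w + v - w = v by abel, hv, mul_one] at this
  have hφb : ∀ m : Fin 4, ∀ i : Fin 4, |div₂ (greenTensor q) (y + e m) i| ≤ K_φ / ((H : ℝ) / 4) ^ 3 := by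
    intro m i
    have hd : (H : ℝ) / 4 ≤ ‖y + e m - q.1‖ := by
      have := norm_sub_norm_le (y - q.1) (-(e m))
      rw [norm_neg, norm_e, show y - q.1 - -e m = y + e m - q.1 by abel] at this
      linarith
    have hne : y + e m ≠ q.1 := by
      intro h; rw [h, sub_self, norm_zero] at hd; linarith
    exact (hKφ q (y + e m) i hne).trans (div_pow_le_div_pow hKφ0 (by positivity) hd 3)
  have hZ : |boxCutoff H y * d₁ (div₂ (greenTensor q)) y k l| ≤ 256 * K_Z / (H : ℝ) ^ 4 := by
    rw [abs_mul]
    have h1 : |boxCutoff H y| ≤ 1 := by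
      obtain ⟨h0, h1⟩ := boxCutoff_mem_Icc H y
      rw [abs_le]; constructor <;> linarith
    have h2 := hKZ q y k l (by linarith)
    have h3 : K_Z / ‖y - q.1‖ ^ 4 ≤ K_Z / ((H : ℝ) / 4) ^ 4 := div_pow_le_div_pow hKZ0 (by positivity) (by linarith) 4
    have h4 : K_Z / ((H : ℝ) / 4) ^ 4 = 256 * K_Z / (H : ℝ) ^ 4 := by field_simp; ring
    calc |boxCutoff H y| * |d₁ (div₂ (greenTensor q)) y k l| ≤ 1 * |d₁ (div₂ (greenTensor q)) y k l| :=
          mul_le_mul_of_nonneg_right h1 (abs_nonneg _)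
      _ ≤ 256 * K_Z / (H : ℝ) ^ 4 := by linarith
  have e4 : (2 / (H : ℝ)) * (K_φ / ((H : ℝ) / 4) ^ 3) = 128 * K_φ / (H : ℝ) ^ 4 := by field_simp; ring
  have t1 : |(boxCutoff H (y + e k) - boxCutoff H y) * div₂ (greenTensor q) (y + e k) l| ≤ 128 * K_φ / (H : ℝ) ^ 4 := by
    rw [abs_mul, ← e4]
    exact mul_le_mul (hχdiff (e k) (norm_e k) y) (hφb k l) (abs_nonneg _) (by positivity)
  have t2 : |(boxCutoff H (y + e l) - boxCutoff H y) * div₂ (greenTensor q) (y + e l) k| ≤ 128 * K_φ / (H : ℝ) ^ 4 := by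
    rw [abs_mul, ← e4]
    exact mul_le_mul (hχdiff (e l) (norm_e l) y) (hφb l k) (abs_nonneg _) (by positivity)
  have e6 : (256 * K_Z + 256 * K_φ) / (H : ℝ) ^ 4 = 256 * K_Z / (H : ℝ) ^ 4 + 128 * K_φ / (H : ℝ) ^ 4 + 128 * K_φ / (H : ℝ) ^ 4 := by
    ring
  rw [e6]
  calc |boxCutoff H y * d₁ (div₂ (greenTensor q)) y k l +
        (boxCutoff H (y + e k) - boxCutoff H y) * div₂ (greenTensor q) (y + e k) l -
        (boxCutoff H (y + e l) - boxCutoff H y) * div₂ (greenTensor q) (y + e l) k|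
      ≤ |boxCutoff H y * d₁ (div₂ (greenTensor q)) y k l + (boxCutoff H (y + e k) - boxCutoff H y) * div₂ (greenTensor q) (y + e k) l| +
        |(boxCutoff H (y + e l) - boxCutoff H y) * div₂ (greenTensor q) (y + e l) k| := abs_sub _ _
    _ ≤ (256 * K_Z / (H : ℝ) ^ 4 + 128 * K_φ / (H : ℝ) ^ 4) + 128 * K_φ / (H : ℝ) ^ 4 :=
        add_le_add ((abs_add_le _ _).trans (add_le_add hZ t1)) t2

end Summit.QuantumFields.YangMills.Theorems.WeakCouplingRates

end
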